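import Literature.Analysis.FluidPDE.NSVorticityBKM
import Literature.Analysis.FluidPDE.NSVorticityBKMSlice
import Literature.Analysis.FluidPDE.NSVorticityBKMEnergy
import Literature.Analysis.FluidPDE.LocalBiotSavartLog
import Literature.Analysis.FluidPDE.SerrinEnstrophyGronwall
import HarnessLib

/-!
# The Beale–Kato–Majda a priori estimate, IV: assembly — discharge of
# `MajdaBertozzi2002_bkmAprioriH3`

Analysis/FluidPDE proof file (theorems only, no definitions, no named facts). It proves the named
fact `Literature.Analysis.FluidPDE.MajdaBertozzi2002_bkmAprioriH3` of `NSVorticityBKM.lean`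
(Majda–Bertozzi, *Vorticity and Incompressible Flow*, CUP 2002, §3.3, proof of Thm. 3.6,
pp. 116–117): for `ν ≥ 0`, `T > 0` and a classical unforced solution `(u, p)` on `ℝ³ × [0, T)`
with all `L²` Sobolev seminorms bounded on every `[0, T'']`, `T'' < T`, the hypothesis
`∫₀ᵀ ‖curl u(t)‖_{L^∞} dt < ∞` bounds `Σ_{n ≤ 3} ∫‖Dⁿu(t)‖²` uniformly in `t ∈ [0, T)`.

The printed proof and its rendering here, on each closed slab `[0, S]`, `S < T`, with constants
independent of `S`:

1. `m = 0`: `‖v(t)‖₀ ≤ ‖v₀‖₀` (Prop. 3.1) — `IsClassicalNSSolutionOn.bkm_energy_le`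
   (`NSVorticityBKMEnergy`, the pressure being canonical in the class).
2. (3.80)–(3.82): `‖ω(t)‖₀² ≤ ‖ω₀‖₀² exp(C∫₀ᵗ|ω|_∞)` — `bkm_vortSq_zero_le` (`NSVorticityBKMSlice`)
   and the measurability-free Grönwall lemma `lintegral_gronwall_le` (`SerrinEnstrophyGronwall`).
3. (3.79) with `m = 3`, on the vorticity equation: `‖∇²ω(t)‖₀² ≤ ‖∇²ω₀‖₀² exp(K∫₀ᵗ|∇v|_∞)` —
   `bkm_vortSq_two_le` and Grönwall.
4. Prop. 3.8 / (3.87) with `ε = (1 + ‖∇²ω‖₀²)⁻¹` and "Sobolev inequality (3.30)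
   `‖ω‖_γ ≤ c‖ω‖₂`": `|∇v(t)|_∞ ≤ C[1 + |ω(t)|_∞ (1 + ln(1 + ‖∇²ω₀‖₀²) + K∫₀ᵗ|∇v|_∞)]`
   — `exists_opNorm_fderiv_le_log`, `exists_holderWith_curl` (`LocalBiotSavartLog`); this is
   the printed "`|∇v(·,t)|_∞ ≤ C[1 + ∫₀ᵗ|∇v|_∞ ds](1 + |ω(·,t)|_∞)`".
5. "Grönwall's lemma implies … an a priori bound … provided that `∫₀ᵗ|ω(·,s)|_∞ ds` is
   bounded": `Φ(t) = 1 + ∫₀ᵗ|∇v|_∞` obeys `Φ(t) ≤ 1 + ∫₀ᵗ K₀(1 + |ω|_∞)Φ`, hence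
   `Φ ≤ exp(K₀(T + ∫₀ᵀ|ω|_∞))`, uniformly in the slab; then 3., 2., 1., the whole-space div–curl
   inequalities `∫|∇v|² ≤ ∫|Ω|²`, `∫|∇³v|² ≤ ∫|∇²Ω|²` and the interpolation of `∇²v`
   (`NSVorticityBKMTools`) bound `Σ_{n≤3}∫‖Dⁿu(t)‖²`.

All time integrals of the suprema `|ω|_∞`, `|∇v|_∞` are lower Lebesgue integrals of the
`ℝ≥0∞`-valued suprema, as in the statement of the fact, so no measurability is ever needed.

## Mathlib / tree search

Tree (all used): `MajdaBertozzi2002_bkmAprioriH3`, `HasBoundedSobolevNormsOn` (`NSVorticityBKM`,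
`NSVorticity`); `IsClassicalNSSolutionOn.bkm_vortSq_zero_le`, `….bkm_vortSq_two_le`
(`NSVorticityBKMSlice`); `….bkm_energy_le` (`NSVorticityBKMEnergy`); `exists_opNorm_fderiv_le_log`,
`exists_holderWith_curl` (`LocalBiotSavartLog`); `lintegral_gronwall_le` (`SerrinEnstrophyGronwall`);
`levelSq_bounds_of_hasBoundedSobolevNormsOn`, `exists_forall_norm_iteratedFDeriv_le_bkmClass`,
`integral_levelSq_two_le_of_one_three`, `vortSq_zero_eq_two_mul_norm_curl_sq` (`NSVorticityBKMTools`);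
`integral_levelSq_succ_le_integral_vortSq` (`NSStrongSpeedBound`); `lintegral_sq_norm_iteratedFDeriv_le`,
`sq_norm_iteratedFDeriv_le_pow_mul_levelSq` (`NSEnstrophyPersistence`, `CoordDerivatives`);
`norm_curl_le_four_mul` (`ElgindiBlowup`); `curl_eq_curlCLM_comp` (`TaoEnstrophyLocalisation`);
`IsClassicalNSSolutionOn.mono` (`ClassicalSolution`). Mathlib: `ContinuousLinearMap.iteratedFDeriv_comp_left`,
`ContinuousLinearMap.norm_compContinuousMultilinearMap_le`, `norm_iteratedFDeriv_fderiv`,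
`lintegral_const_mul'`, `lintegral_add_left`, `ENNReal.ofReal_le_ofReal_iff`.

## References

* A. J. Majda, A. L. Bertozzi, *Vorticity and Incompressible Flow*, CUP 2002, §3.3, Thm. 3.6
  and its proof: (3.79)–(3.83), Prop. 3.8 (held text pp. 115–117). [MajdaBertozzi2002]
* J. T. Beale, T. Kato, A. Majda, Comm. Math. Phys. 94 (1984), 61–66, Thm. 1 and its proof.
  [BealeKatoMajda1984]
-/

noncomputable section

open MeasureTheory Set Function Filter Metric
open _root_.Topology
open scoped ENNReal NNReal ContDiff

namespace Literature.Analysis.FluidPDE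

/-! ## Generic tools: suprema as real numbers, and Grönwall from a lower-integral bound -/

section Tools

/-- The real-valued supremum of the pointwise norms of a bounded function: with
`s = (⨆ x, ‖f x‖ₑ).toReal`, `‖f x‖ ≤ s ≤ B` whenever `‖f‖ ≤ B`, and `ofReal s = ⨆ x, ‖f x‖ₑ`.
[folklore] -/
theorem toReal_iSup_enorm_spec {X F : Type*} [Nonempty X] [NormedAddCommGroup F] {f : X → F}
    {B : ℝ} (hB : ∀ x, ‖f x‖ ≤ B) :
    (∀ x, ‖f x‖ ≤ (⨆ x, ‖f x‖ₑ).toReal) ∧ (⨆ x, ‖f x‖ₑ).toReal ≤ B ∧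
      ENNReal.ofReal ((⨆ x, ‖f x‖ₑ).toReal) = ⨆ x, ‖f x‖ₑ := by
  have hB0 : 0 ≤ B := (norm_nonneg _).trans (hB (Classical.arbitrary X))
  have hsup : (⨆ x, ‖f x‖ₑ) ≤ ENNReal.ofReal B := iSup_le fun x => by
    rw [← ofReal_norm]; exact ENNReal.ofReal_le_ofReal (hB x)
  have htop : (⨆ x, ‖f x‖ₑ) ≠ ⊤ := ne_top_of_le_ne_top ENNReal.ofReal_ne_top hsup
  refine ⟨fun x => ?_, ?_, ENNReal.ofReal_toReal htop⟩
  · have h1 : ‖f x‖ₑ ≤ ⨆ x, ‖f x‖ₑ := le_iSup (fun x => ‖f x‖ₑ) x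
    calc ‖f x‖ = (‖f x‖ₑ).toReal := (toReal_enorm _).symm
      _ ≤ (⨆ x, ‖f x‖ₑ).toReal := ENNReal.toReal_mono htop h1
  · exact (ENNReal.toReal_mono ENNReal.ofReal_ne_top hsup).trans (le_of_eq (ENNReal.toReal_ofReal hB0))

/-- **Grönwall from a lower-integral bound, real form.** If `0 ≤ X ≤ M` on `[0, S]`,
`0 ≤ c` on `[0, S]` with `∫₀^S c < ∞` (lower integral), and
`X(t) ≤ X(0) + ∫_{(0,t)} c X` (lower integral, `toReal`) for every `t ∈ [0, S]`, then
`X(t) ≤ X(0) exp(∫_{(0,t)} c)` on `[0, S]` — the tree's measurability-free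
`lintegral_gronwall_le` transported to real-valued functions. [folklore] -/
theorem real_gronwall_of_lintegral_bound {S : ℝ} {X c : ℝ → ℝ} {M : ℝ}
    (hX0 : ∀ t ∈ Icc 0 S, 0 ≤ X t) (hXM : ∀ t ∈ Icc 0 S, X t ≤ M)
    (hc0 : ∀ t ∈ Icc 0 S, 0 ≤ c t) (hcfin : ∫⁻ t in Ioo 0 S, ENNReal.ofReal (c t) ≠ ⊤)
    (h : ∀ t ∈ Icc 0 S, X t ≤ X 0 + (∫⁻ s in Ioo 0 t, ENNReal.ofReal (c s * X s)).toReal) :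
    ∀ t ∈ Icc 0 S, X t ≤ X 0 * Real.exp (∫⁻ s in Ioo 0 t, ENNReal.ofReal (c s)).toReal := by
  intro t ht
  by_cases hS : S < 0
  · exact absurd (ht.1.trans ht.2) (not_le.2 hS)
  rw [not_lt] at hS
  have h0S : (0 : ℝ) ∈ Icc 0 S := ⟨le_rfl, hS⟩
  -- the `ℝ≥0∞`-valued functions
  set φ : ℝ → ℝ≥0∞ := fun t => ENNReal.ofReal (X t) with hφ
  set a : ℝ → ℝ≥0∞ := fun t => ENNReal.ofReal (c t) with ha
  have hφM : ∀ t ∈ Icc 0 S, φ t ≤ ENNReal.ofReal M := fun t ht => ENNReal.ofReal_le_ofReal (hXM t ht)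
  have hineq : ∀ t ∈ Icc 0 S, φ t ≤ ENNReal.ofReal (X 0) + ∫⁻ s in Ioo 0 t, a s * φ s := by
    intro t ht
    calc φ t = ENNReal.ofReal (X t) := rfl
      _ ≤ ENNReal.ofReal (X 0 + (∫⁻ s in Ioo 0 t, ENNReal.ofReal (c s * X s)).toReal) :=
          ENNReal.ofReal_le_ofReal (h t ht)
      _ ≤ ENNReal.ofReal (X 0) + ENNReal.ofReal ((∫⁻ s in Ioo 0 t, ENNReal.ofReal (c s * X s)).toReal) :=
          ENNReal.ofReal_add_le
      _ ≤ ENNReal.ofReal (X 0) + ∫⁻ s in Ioo 0 t, ENNReal.ofReal (c s * X s) :=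
          add_le_add le_rfl ENNReal.ofReal_toReal_le
      _ ≤ ENNReal.ofReal (X 0) + ∫⁻ s in Ioo 0 t, a s * φ s :=
          add_le_add le_rfl (setLIntegral_mono' measurableSet_Ioo fun s hs => by
            have hs' : s ∈ Icc 0 S := ⟨hs.1.le, hs.2.le.trans ht.2⟩
            show ENNReal.ofReal (c s * X s) ≤ ENNReal.ofReal (c s) * ENNReal.ofReal (X s)
            rw [← ENNReal.ofReal_mul (hc0 s hs')])
  have hG := lintegral_gronwall_le (φ := φ) (a := a) ENNReal.ofReal_ne_top ENNReal.ofReal_ne_top hφM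
    hcfin hineq t ht
  -- back to real numbers
  have hexp : 0 ≤ Real.exp (∫⁻ s in Ioo 0 t, a s).toReal := (Real.exp_pos _).le
  have h1 : ENNReal.ofReal (X t) ≤ ENNReal.ofReal (X 0 * Real.exp (∫⁻ s in Ioo 0 t, a s).toReal) := by
    rw [ENNReal.ofReal_mul (hX0 0 h0S)]; exact hG
  exact (ENNReal.ofReal_le_ofReal_iff (mul_nonneg (hX0 0 h0S) hexp)).1 h1

/-- **Grönwall for the running integral of the velocity-gradient supremum** (the step
"`|∇v(·,t)|_∞ ≤ C[1 + ∫₀ᵗ|∇v|_∞](1 + |ω(·,t)|_∞)`, Grönwall's lemma implies …" of the printed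
proof, p. 117): if `0 ≤ G ≤ B` and `0 ≤ a` on `[0, S]`, `∫_{(0,S)} a ≤ I_ω` (lower integral) and
`G(τ) ≤ K₀ (1 + a(τ)) (1 + ∫_{(0,τ)} G)` on `[0, S]`, then `∫_{(0,t)} G ≤ exp(K₀ (S + I_ω))` for
`t ∈ [0, S]` (apply `lintegral_gronwall_le` to `Φ = 1 + ∫ G`). [cite: MajdaBertozzi2002, §3.3 proof of Thm. 3.6 (Grönwall step, p. 117)] -/
theorem toReal_lintegral_le_exp_of_log_gronwall {S : ℝ} {G a : ℝ → ℝ} {K₀ B Iω : ℝ}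
    (hS : 0 ≤ S) (hG0 : ∀ τ ∈ Icc 0 S, 0 ≤ G τ) (hGB : ∀ τ ∈ Icc 0 S, G τ ≤ B)
    (ha0 : ∀ τ ∈ Icc 0 S, 0 ≤ a τ)
    (haI : (∫⁻ τ in Ioo 0 S, ENNReal.ofReal (a τ)) ≤ ENNReal.ofReal Iω) (hIω : 0 ≤ Iω)
    (hK0 : 0 ≤ K₀)
    (h : ∀ τ ∈ Icc 0 S, G τ ≤ K₀ * (1 + a τ) * (1 + (∫⁻ s in Ioo 0 τ, ENNReal.ofReal (G s)).toReal)) :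
    ∀ t ∈ Icc 0 S, (∫⁻ s in Ioo 0 t, ENNReal.ofReal (G s)).toReal ≤ Real.exp (K₀ * (S + Iω)) := by
  have hB0 : 0 ≤ B := (hG0 0 ⟨le_rfl, hS⟩).trans (hGB 0 ⟨le_rfl, hS⟩)
  set Λ : ℝ → ℝ≥0∞ := fun t => ∫⁻ s in Ioo 0 t, ENNReal.ofReal (G s) with hΛ
  set Φ : ℝ → ℝ≥0∞ := fun t => 1 + Λ t with hΦ
  set aR : ℝ → ℝ≥0∞ := fun τ => ENNReal.ofReal (K₀ * (1 + a τ)) with haR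
  -- `Λ` is bounded on `[0, S]`
  have hΛle : ∀ t ∈ Icc 0 S, Λ t ≤ ENNReal.ofReal B * ENNReal.ofReal S := by
    intro t ht
    calc Λ t ≤ ∫⁻ _ in Ioo (0 : ℝ) t, ENNReal.ofReal B :=
          setLIntegral_mono' measurableSet_Ioo fun s hs =>
            ENNReal.ofReal_le_ofReal (hGB s ⟨hs.1.le, hs.2.le.trans ht.2⟩)
      _ = ENNReal.ofReal B * ENNReal.ofReal t := by rw [setLIntegral_const, Real.volume_Ioo, sub_zero]
      _ ≤ ENNReal.ofReal B * ENNReal.ofReal S := mul_le_mul_right (ENNReal.ofReal_le_ofReal ht.2) _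
  have hΛfin : ∀ t ∈ Icc 0 S, Λ t ≠ ⊤ := fun t ht =>
    ne_top_of_le_ne_top (ENNReal.mul_ne_top ENNReal.ofReal_ne_top ENNReal.ofReal_ne_top) (hΛle t ht)
  have hΦM : ∀ t ∈ Icc 0 S, Φ t ≤ 1 + ENNReal.ofReal B * ENNReal.ofReal S := fun t ht =>
    add_le_add le_rfl (hΛle t ht)
  -- the Grönwall kernel has a finite integral
  have haR_int : ∫⁻ τ in Ioo 0 S, aR τ ≤ ENNReal.ofReal K₀ * (ENNReal.ofReal S + ENNReal.ofReal Iω) := by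
    have hsplit : ∀ τ, aR τ ≤ ENNReal.ofReal K₀ * ((fun _ => (1 : ℝ≥0∞)) τ + ENNReal.ofReal (a τ)) := fun τ => by
      show ENNReal.ofReal (K₀ * (1 + a τ)) ≤ ENNReal.ofReal K₀ * (1 + ENNReal.ofReal (a τ))
      by_cases hat : 0 ≤ a τ
      · rw [ENNReal.ofReal_mul hK0, ENNReal.ofReal_add zero_le_one hat, ENNReal.ofReal_one]
      · rw [not_le] at hat
        calc ENNReal.ofReal (K₀ * (1 + a τ)) ≤ ENNReal.ofReal (K₀ * 1) :=
              ENNReal.ofReal_le_ofReal (mul_le_mul_of_nonneg_left (by linarith) hK0)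
          _ = ENNReal.ofReal K₀ * ((1 : ℝ≥0∞) + 0) := by rw [mul_one, add_zero, mul_one]
          _ ≤ ENNReal.ofReal K₀ * (1 + ENNReal.ofReal (a τ)) := by gcongr; exact bot_le
    calc ∫⁻ τ in Ioo 0 S, aR τ
        ≤ ∫⁻ τ in Ioo 0 S, ENNReal.ofReal K₀ * ((fun _ => (1 : ℝ≥0∞)) τ + ENNReal.ofReal (a τ)) :=
          lintegral_mono hsplit
      _ = ENNReal.ofReal K₀ * ((∫⁻ _ in Ioo (0 : ℝ) S, (1 : ℝ≥0∞)) + ∫⁻ τ in Ioo 0 S, ENNReal.ofReal (a τ)) := by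
          rw [lintegral_const_mul' _ _ ENNReal.ofReal_ne_top, lintegral_add_left measurable_const]
      _ ≤ ENNReal.ofReal K₀ * (ENNReal.ofReal S + ENNReal.ofReal Iω) := by
          rw [setLIntegral_const, Real.volume_Ioo, sub_zero, one_mul]
          exact mul_le_mul_right (add_le_add le_rfl haI) _
  have haR_fin : ∫⁻ τ in Ioo 0 S, aR τ ≠ ⊤ :=
    ne_top_of_le_ne_top (ENNReal.mul_ne_top ENNReal.ofReal_ne_top
      (ENNReal.add_ne_top.2 ⟨ENNReal.ofReal_ne_top, ENNReal.ofReal_ne_top⟩)) haR_int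
  -- the integral inequality for `Φ`
  have hΦineq : ∀ t ∈ Icc 0 S, Φ t ≤ 1 + ∫⁻ s in Ioo 0 t, aR s * Φ s := by
    intro t ht
    refine add_le_add le_rfl (setLIntegral_mono' measurableSet_Ioo fun s hs => ?_)
    have hs' : s ∈ Icc 0 S := ⟨hs.1.le, hs.2.le.trans ht.2⟩
    have h1 := h s hs'
    have hΦs : Φ s = ENNReal.ofReal (1 + (Λ s).toReal) := by
      rw [hΦ]; simp only
      rw [ENNReal.ofReal_add zero_le_one ENNReal.toReal_nonneg, ENNReal.ofReal_one,
        ENNReal.ofReal_toReal (hΛfin s hs')]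
    rw [hΦs, haR, ← ENNReal.ofReal_mul (by nlinarith [ha0 s hs'])]
    exact ENNReal.ofReal_le_ofReal h1
  -- Grönwall
  intro t ht
  have hG := lintegral_gronwall_le (φ := Φ) (a := aR) ENNReal.one_ne_top
    (ENNReal.add_ne_top.2 ⟨ENNReal.one_ne_top, ENNReal.mul_ne_top ENNReal.ofReal_ne_top ENNReal.ofReal_ne_top⟩)
    hΦM haR_fin hΦineq t ht
  rw [one_mul] at hG
  have hexp_arg : (∫⁻ s in Ioo 0 t, aR s).toReal ≤ K₀ * (S + Iω) := by
    have h1 : ∫⁻ s in Ioo 0 t, aR s ≤ ENNReal.ofReal K₀ * (ENNReal.ofReal S + ENNReal.ofReal Iω) :=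
      (lintegral_mono_set (Ioo_subset_Ioo le_rfl ht.2)).trans haR_int
    have h2 := ENNReal.toReal_mono (ENNReal.mul_ne_top ENNReal.ofReal_ne_top
      (ENNReal.add_ne_top.2 ⟨ENNReal.ofReal_ne_top, ENNReal.ofReal_ne_top⟩)) h1
    rw [ENNReal.toReal_mul, ENNReal.toReal_add ENNReal.ofReal_ne_top ENNReal.ofReal_ne_top,
      ENNReal.toReal_ofReal hK0, ENNReal.toReal_ofReal hS, ENNReal.toReal_ofReal hIω] at h2
    exact h2
  calc (Λ t).toReal ≤ (Φ t).toReal := by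
        refine ENNReal.toReal_mono ?_ (le_add_self)
        exact ENNReal.add_ne_top.2 ⟨ENNReal.one_ne_top, hΛfin t ht⟩
    _ ≤ (ENNReal.ofReal (Real.exp (∫⁻ s in Ioo 0 t, aR s).toReal)).toReal :=
        ENNReal.toReal_mono ENNReal.ofReal_ne_top hG
    _ = Real.exp (∫⁻ s in Ioo 0 t, aR s).toReal := ENNReal.toReal_ofReal (Real.exp_pos _).le
    _ ≤ Real.exp (K₀ * (S + Iω)) := Real.exp_le_exp.2 hexp_arg

end Tools

/-! ## The Sobolev seminorms of the vorticity in terms of the coordinate tensors -/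

section CurlSobolev

/-- `‖curlCLM‖ ≤ 4` (from `‖curl v(x)‖ ≤ 4‖Dv(x)‖`, `norm_curl_le_four_mul`, applied to a linear
field). [folklore] -/
theorem norm_curlCLM_le_four : ‖curlCLM‖ ≤ 4 := by
  refine ContinuousLinearMap.opNorm_le_bound _ (by norm_num) fun L => ?_
  have h := norm_curl_le_four_mul (fun y => L y) 0
  rw [curl_eq_curlCLM] at h
  have hL : fderiv ℝ (fun y => L y) 0 = L := L.fderiv
  rwa [hL] at h

/-- `‖D²(curl v)(y)‖ ≤ 4 ‖D³v(y)‖` for smooth `v` (`curl v = curlCLM ∘ Dv`). [folklore] -/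
theorem norm_iteratedFDeriv_curl_le_four_mul {v : EuclideanSpace ℝ (Fin 3) → EuclideanSpace ℝ (Fin 3)}
    (hv : ContDiff ℝ ∞ v) (i : ℕ) (y : EuclideanSpace ℝ (Fin 3)) :
    ‖iteratedFDeriv ℝ i (curl v) y‖ ≤ 4 * ‖iteratedFDeriv ℝ (i + 1) v y‖ := by
  have hDv : ContDiff ℝ ∞ (fderiv ℝ v) := (contDiff_infty_iff_fderiv.1 hv).2
  rw [curl_eq_curlCLM_comp, ContinuousLinearMap.iteratedFDeriv_comp_left curlCLM (hDv.contDiffAt (x := y))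
    (by exact_mod_cast le_top), ← norm_iteratedFDeriv_fderiv]
  exact (ContinuousLinearMap.norm_compContinuousMultilinearMap_le _ _).trans
    (mul_le_mul_of_nonneg_right norm_curlCLM_le_four (norm_nonneg _))

/-- `∫ ‖Dⁱ(curl v)‖² ≤ 16 · 3^{i+2} ∫ |∇^{i+1}v|²` in `ℝ≥0∞` form, hence the `eLpNorm` bound
`‖Dⁱ curl v‖_{L²} ≤ (ofReal (16 · 3^{i+2} ∫|∇^{i+1}v|²))^{1/2}` when `|∇^{i+1}v|² ∈ L¹`. [folklore] -/
theorem eLpNorm_iteratedFDeriv_curl_le {v : EuclideanSpace ℝ (Fin 3) → EuclideanSpace ℝ (Fin 3)}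
    (hv : ContDiff ℝ ∞ v) (i : ℕ) (hint : Integrable (levelSq (i + 1) v)) :
    eLpNorm (iteratedFDeriv ℝ i (curl v)) 2 volume ≤
      (ENNReal.ofReal (16 * 3 ^ (i + 2) * ∫ x, levelSq (i + 1) v x)) ^ (1 / 2 : ℝ) := by
  refine eLpNorm_two_le_rpow_of_lintegral_sq_le ?_
  have hpt : ∀ y, ‖iteratedFDeriv ℝ i (curl v) y‖ₑ ^ 2 ≤
      ENNReal.ofReal (16 * 3 ^ (i + 2) * levelSq (i + 1) v y) := fun y => by
    rw [← ofReal_norm, ← ENNReal.ofReal_pow (norm_nonneg _)]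
    refine ENNReal.ofReal_le_ofReal ?_
    have h1 := norm_iteratedFDeriv_curl_le_four_mul hv i y
    have h2 := sq_norm_iteratedFDeriv_le_pow_mul_levelSq hv (i + 1) y
    calc ‖iteratedFDeriv ℝ i (curl v) y‖ ^ 2 ≤ (4 * ‖iteratedFDeriv ℝ (i + 1) v y‖) ^ 2 :=
          pow_le_pow_left₀ (norm_nonneg _) h1 2
      _ = 16 * ‖iteratedFDeriv ℝ (i + 1) v y‖ ^ 2 := by ring
      _ ≤ 16 * (3 ^ (i + 1 + 1) * levelSq (i + 1) v y) := mul_le_mul_of_nonneg_left h2 (by norm_num)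
      _ = 16 * 3 ^ (i + 2) * levelSq (i + 1) v y := by ring
  calc ∫⁻ y, ‖iteratedFDeriv ℝ i (curl v) y‖ₑ ^ 2
      ≤ ∫⁻ y, ENNReal.ofReal (16 * 3 ^ (i + 2) * levelSq (i + 1) v y) := lintegral_mono hpt
    _ = ENNReal.ofReal (∫ y, 16 * 3 ^ (i + 2) * levelSq (i + 1) v y) := by
        rw [ofReal_integral_eq_lintegral_ofReal (hint.const_mul _)
          (Eventually.of_forall fun y => mul_nonneg (by positivity) (levelSq_nonneg _ _ _))]
    _ = ENNReal.ofReal (16 * 3 ^ (i + 2) * ∫ y, levelSq (i + 1) v y) := by rw [integral_const_mul]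

/-- `‖Dh(x)‖ = ‖D¹h(x)‖` (curried vs. uncurried first derivative). [folklore] -/
private theorem bkm_norm_fderiv_eq_norm_iteratedFDeriv_one
    (h : EuclideanSpace ℝ (Fin 3) → EuclideanSpace ℝ (Fin 3)) (x : EuclideanSpace ℝ (Fin 3)) :
    ‖fderiv ℝ h x‖ = ‖iteratedFDeriv ℝ 1 h x‖ := by
  rw [← norm_iteratedFDeriv_fderiv (n := 0), norm_iteratedFDeriv_zero]

/-- The `½`-Hölder constant input of the logarithmic estimate: `D(curl v), D²(curl v) ∈ L²`
with `‖D² curl v‖_{L²} ≤ 36 (∫|∇³v|²)^{1/2}` when `|∇²v|², |∇³v|² ∈ L¹`. [folklore] -/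
theorem eLpNorm_fderiv_fderiv_curl_bounds {v : EuclideanSpace ℝ (Fin 3) → EuclideanSpace ℝ (Fin 3)}
    (hv : ContDiff ℝ ∞ v) (h2 : Integrable (levelSq 2 v)) (h3 : Integrable (levelSq 3 v)) :
    eLpNorm (fderiv ℝ (curl v)) 2 volume < ⊤ ∧
      eLpNorm (fderiv ℝ (fderiv ℝ (curl v))) 2 volume < ⊤ ∧
      (eLpNorm (fderiv ℝ (fderiv ℝ (curl v))) 2 volume).toReal ≤
        36 * Real.sqrt (∫ x, levelSq 3 v x) := by
  have e1 : eLpNorm (fderiv ℝ (curl v)) 2 volume = eLpNorm (iteratedFDeriv ℝ 1 (curl v)) 2 volume := by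
    rw [← eLpNorm_norm (fderiv ℝ (curl v)), ← eLpNorm_norm (iteratedFDeriv ℝ 1 (curl v))]
    simp_rw [bkm_norm_fderiv_eq_norm_iteratedFDeriv_one]
  have e2 : eLpNorm (fderiv ℝ (fderiv ℝ (curl v))) 2 volume = eLpNorm (iteratedFDeriv ℝ 2 (curl v)) 2 volume := by
    rw [← eLpNorm_norm (fderiv ℝ (fderiv ℝ (curl v))), ← eLpNorm_norm (iteratedFDeriv ℝ 2 (curl v))]
    simp_rw [FunctionSpaces.norm_fderiv_fderiv_eq_norm_iteratedFDeriv_two]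
  have b1 := eLpNorm_iteratedFDeriv_curl_le hv 1 h2
  have b2 := eLpNorm_iteratedFDeriv_curl_le hv 2 h3
  have hI3 : 0 ≤ ∫ x, levelSq 3 v x := integral_nonneg fun x => levelSq_nonneg 3 v x
  refine ⟨?_, ?_, ?_⟩
  · rw [e1]; exact b1.trans_lt (ENNReal.rpow_lt_top_of_nonneg (by norm_num) ENNReal.ofReal_ne_top)
  · rw [e2]; exact b2.trans_lt (ENNReal.rpow_lt_top_of_nonneg (by norm_num) ENNReal.ofReal_ne_top)
  · rw [e2]
    have h := ENNReal.toReal_mono (ENNReal.rpow_ne_top_of_nonneg (by norm_num) ENNReal.ofReal_ne_top) b2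
    refine h.trans (le_of_eq ?_)
    rw [← ENNReal.toReal_rpow, ENNReal.toReal_ofReal (by positivity), ← Real.sqrt_eq_rpow,
      show (16 * 3 ^ (2 + 2) * ∫ x, levelSq 3 v x) = 36 ^ 2 * ∫ x, levelSq 3 v x by norm_num,
      Real.sqrt_mul (by norm_num), Real.sqrt_sq (by norm_num)]

end CurlSobolev

/-! ## The logarithmic estimate at a fixed time, with `ε = (1 + X)⁻¹` -/

section LogStep

/-- **Prop. 3.8 with the printed choice of `ε`** ("taking `ε = ‖v‖₃^{−γ}` … gives relation
(3.83)", p. 117; here `ε = (1 + X)⁻¹` with `X ≥ ∫|∇³v|²`, `γ = ½`): for a smooth divergence-free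
`v` of finite energy with `|∇²v|², |∇³v|² ∈ L¹`, `∫|∇³v|² ≤ X`, and `|curl v| ≤ a`, every point `x`
satisfies `‖Dv(x)‖ ≤ C_L (36 C_H + a + a log(1 + X) + (∫|v|²)^{1/2})`, where `C_L`, `C_H` are the
constants of `exists_opNorm_fderiv_le_log` and `exists_holderWith_curl`. [cite: MajdaBertozzi2002, §3.3 Prop. 3.8, (3.83) and its proof (pp. 116–117)] -/
theorem opNorm_fderiv_le_bkm_log {CL : ℝ} (hCL0 : 0 ≤ CL)
    (hCL : ∀ (v : EuclideanSpace ℝ (Fin 3) → EuclideanSpace ℝ (Fin 3)), ContDiff ℝ ∞ v →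
      VectorCalculus.IsDivFree v → Integrable (fun y => ‖v y‖ ^ 2) →
      ∀ (H Ω : ℝ≥0), HolderWith H (1 / 2) (curl v) → (∀ y, ‖curl v y‖ ≤ Ω) →
      ∀ δ : ℝ, 0 < δ → δ ≤ 1 → ∀ x : EuclideanSpace ℝ (Fin 3),
        ‖fderiv ℝ v x‖ ≤ CL * ((H + Ω) * δ ^ (1 / 2 : ℝ) + Ω * Real.log (1 / δ) +
          Real.sqrt (∫ y, ‖v y‖ ^ 2)))
    {CH : ℝ≥0}
    (hCH : ∀ (v : EuclideanSpace ℝ (Fin 3) → EuclideanSpace ℝ (Fin 3)), ContDiff ℝ 3 v →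
      eLpNorm (fderiv ℝ (curl v)) 2 volume < ⊤ →
      eLpNorm (fderiv ℝ (fderiv ℝ (curl v))) 2 volume < ⊤ →
      HolderWith (CH * (eLpNorm (fderiv ℝ (fderiv ℝ (curl v))) 2 volume).toNNReal) (1 / 2) (curl v))
    {v : EuclideanSpace ℝ (Fin 3) → EuclideanSpace ℝ (Fin 3)} (hv : ContDiff ℝ ∞ v)
    (hdiv : VectorCalculus.IsDivFree v) (hE : Integrable fun y => ‖v y‖ ^ 2)
    (h2 : Integrable (levelSq 2 v)) (h3 : Integrable (levelSq 3 v)) {X : ℝ}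
    (hX : ∫ x, levelSq 3 v x ≤ X) {a : ℝ} (ha : ∀ y, ‖curl v y‖ ≤ a) (x : EuclideanSpace ℝ (Fin 3)) :
    ‖fderiv ℝ v x‖ ≤ CL * (36 * CH + a + a * Real.log (1 + X) + Real.sqrt (∫ y, ‖v y‖ ^ 2)) := by
  obtain ⟨hf1, hf2, hf3⟩ := eLpNorm_fderiv_fderiv_curl_bounds hv h2 h3
  have hH := hCH v (hv.of_le (by norm_cast)) hf1 hf2
  have ha0 : 0 ≤ a := (norm_nonneg _).trans (ha 0)
  have hI3 : 0 ≤ ∫ x, levelSq 3 v x := integral_nonneg fun x => levelSq_nonneg 3 v x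
  have hX0 : 0 ≤ X := hI3.trans hX
  set S₂ : ℝ := (eLpNorm (fderiv ℝ (fderiv ℝ (curl v))) 2 volume).toReal with hS₂
  have hS₂0 : 0 ≤ S₂ := ENNReal.toReal_nonneg
  have hS₂le : S₂ ≤ 36 * Real.sqrt X := hf3.trans (mul_le_mul_of_nonneg_left (Real.sqrt_le_sqrt hX) (by norm_num))
  set δ : ℝ := 1 / (1 + X) with hδ
  have hδ0 : 0 < δ := by rw [hδ]; positivity
  have hδ1 : δ ≤ 1 := by rw [hδ, div_le_one (by positivity)]; linarith
  have ha' : ∀ y, ‖curl v y‖ ≤ (a.toNNReal : ℝ) := fun y => by rw [Real.coe_toNNReal _ ha0]; exact ha y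
  have hmain := hCL v hv hdiv hE _ _ hH ha' δ hδ0 hδ1 x
  refine hmain.trans (mul_le_mul_of_nonneg_left ?_ hCL0)
  -- the algebra of the choice of `δ`
  have hcoeH : ((CH * (eLpNorm (fderiv ℝ (fderiv ℝ (curl v))) 2 volume).toNNReal : ℝ≥0) : ℝ) = CH * S₂ := by
    rw [NNReal.coe_mul]; rfl
  have hcoeΩ : ((a.toNNReal : ℝ≥0) : ℝ) = a := Real.coe_toNNReal _ ha0
  rw [hcoeH, hcoeΩ]
  have hsqδ : δ ^ (1 / 2 : ℝ) = Real.sqrt δ := (Real.sqrt_eq_rpow δ).symm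
  have hδle : Real.sqrt δ ≤ 1 := by rw [← Real.sqrt_one]; exact Real.sqrt_le_sqrt hδ1
  have hXδ : Real.sqrt X * Real.sqrt δ ≤ 1 := by
    rw [← Real.sqrt_mul hX0, ← Real.sqrt_one]
    refine Real.sqrt_le_sqrt ?_
    rw [hδ, mul_one_div, div_le_one (by positivity)]
    linarith
  have hlog : Real.log (1 / δ) = Real.log (1 + X) := by rw [hδ, one_div_one_div]
  rw [hsqδ, hlog]
  have hCH0 : (0 : ℝ) ≤ CH := CH.coe_nonneg
  have hlog0 : 0 ≤ Real.log (1 + X) := Real.log_nonneg (by linarith)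
  have h1 : (CH * S₂ + a) * Real.sqrt δ ≤ 36 * CH + a := by
    have hS : CH * S₂ * Real.sqrt δ ≤ 36 * CH := by
      calc CH * S₂ * Real.sqrt δ ≤ CH * (36 * Real.sqrt X) * Real.sqrt δ :=
            mul_le_mul_of_nonneg_right (mul_le_mul_of_nonneg_left hS₂le hCH0) (Real.sqrt_nonneg _)
        _ = 36 * CH * (Real.sqrt X * Real.sqrt δ) := by ring
        _ ≤ 36 * CH * 1 := mul_le_mul_of_nonneg_left hXδ (by positivity)
        _ = 36 * CH := mul_one _
    have hA : a * Real.sqrt δ ≤ a := by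
      calc a * Real.sqrt δ ≤ a * 1 := mul_le_mul_of_nonneg_left hδle ha0
        _ = a := mul_one _
    nlinarith [hS, hA]
  linarith [h1]

end LogStep

/-! ## The a priori estimate on a closed slab, with constants independent of the slab -/

section Slab

variable {S ν : ℝ} {u : ℝ → (EuclideanSpace ℝ (Fin 3)) → (EuclideanSpace ℝ (Fin 3))}
  {p : ℝ → (EuclideanSpace ℝ (Fin 3)) → ℝ}

/-- `log (1 + X) ≤ log (1 + X₀) + L` when `0 ≤ X ≤ X₀ exp L`, `0 ≤ X₀`, `0 ≤ L`. [folklore] -/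
theorem log_one_add_le_of_le_mul_exp {X X₀ L : ℝ} (hX : 0 ≤ X) (hX₀ : 0 ≤ X₀) (hL : 0 ≤ L)
    (h : X ≤ X₀ * Real.exp L) : Real.log (1 + X) ≤ Real.log (1 + X₀) + L := by
  have h1 : 1 + X ≤ (1 + X₀) * Real.exp L := by
    have := Real.one_le_exp hL  -- `1 ≤ exp L`
    nlinarith [Real.add_one_le_exp L, Real.exp_pos L]
  calc Real.log (1 + X) ≤ Real.log ((1 + X₀) * Real.exp L) :=
        Real.log_le_log (by linarith) h1
    _ = Real.log (1 + X₀) + L := by rw [Real.log_mul (by positivity) (Real.exp_pos L).ne', Real.log_exp]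
set_option maxHeartbeats 400000 in -- buildfix (bf3-g26): 160k/180k FAIL, 200k PASS at accept time; line-neutral budget line
/-- **The Beale–Kato–Majda a priori estimate on a closed slab** (Majda–Bertozzi, proof of
Thm. 3.6, pp. 116–117, with all constants written out). For `ν ≥ 0` and an unforced classical
solution on `[0, S] × ℝ³`, `S > 0`, with all Sobolev seminorms bounded on `[0, S]`, whose
vorticity satisfies `∫_{(0,S)} sup_x |curl u| ≤ I_ω`, and `S ≤ T`: for every `t ∈ [0, S]`,
`Σ_{n ≤ 3} ∫‖Dⁿu(t)‖²` is bounded by an explicit expression in `∫|u(0)|²`, `∫|Ω(0)|²`,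
`∫|∇²Ω(0)|²`, `I_ω`, `T` and the absolute constants `C_L`, `C_H` of the logarithmic estimate —
independent of `S`. [cite: MajdaBertozzi2002, §3.3 proof of Thm. 3.6, (3.79)–(3.83) (pp. 116–117)] -/
theorem IsClassicalNSSolutionOn.bkm_slab_bound (hν : 0 ≤ ν) (hS : 0 < S)
    (h : IsClassicalNSSolutionOn (Icc 0 S) ν 0 u p) (hB : HasBoundedSobolevNormsOn (Icc 0 S) u)
    {CL : ℝ} (hCL0 : 0 ≤ CL)
    (hCL : ∀ (v : EuclideanSpace ℝ (Fin 3) → EuclideanSpace ℝ (Fin 3)), ContDiff ℝ ∞ v →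
      VectorCalculus.IsDivFree v → Integrable (fun y => ‖v y‖ ^ 2) →
      ∀ (H Ω : ℝ≥0), HolderWith H (1 / 2) (curl v) → (∀ y, ‖curl v y‖ ≤ Ω) →
      ∀ δ : ℝ, 0 < δ → δ ≤ 1 → ∀ x : EuclideanSpace ℝ (Fin 3),
        ‖fderiv ℝ v x‖ ≤ CL * ((H + Ω) * δ ^ (1 / 2 : ℝ) + Ω * Real.log (1 / δ) +
          Real.sqrt (∫ y, ‖v y‖ ^ 2)))
    {CH : ℝ≥0}
    (hCH : ∀ (v : EuclideanSpace ℝ (Fin 3) → EuclideanSpace ℝ (Fin 3)), ContDiff ℝ 3 v →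
      eLpNorm (fderiv ℝ (curl v)) 2 volume < ⊤ →
      eLpNorm (fderiv ℝ (fderiv ℝ (curl v))) 2 volume < ⊤ →
      HolderWith (CH * (eLpNorm (fderiv ℝ (fderiv ℝ (curl v))) 2 volume).toNNReal) (1 / 2) (curl v))
    {Iω : ℝ} (hIω0 : 0 ≤ Iω)
    (hωS : (∫⁻ τ in Ioo 0 S, ⨆ x, ‖curl (u τ) x‖ₑ) ≤ ENNReal.ofReal Iω)
    {T : ℝ} (hST : S ≤ T) {t : ℝ} (ht : t ∈ Icc 0 S) :
    (∑ n ∈ Finset.range 4, ∫⁻ x, ‖iteratedFDeriv ℝ n (u t) x‖ₑ ^ 2) ≤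
      ENNReal.ofReal (3 * (∫ x, ‖u 0 x‖ ^ 2) +
        9 * ((∫ x, vortSq 0 (u 0) x) * Real.exp (432 * Iω)) +
        27 * ((3 * ((∫ x, vortSq 0 (u 0) x) * Real.exp (432 * Iω)) +
          (∫ x, vortSq 2 (u 0) x) * Real.exp (979776 * Real.exp
            (CL * (36 * CH + Real.sqrt (∫ x, ‖u 0 x‖ ^ 2) + 1 +
              Real.log (1 + ∫ x, vortSq 2 (u 0) x) + 979776) * (T + Iω)))) / 2) +
        81 * ((∫ x, vortSq 2 (u 0) x) * Real.exp (979776 * Real.exp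
            (CL * (36 * CH + Real.sqrt (∫ x, ‖u 0 x‖ ^ 2) + 1 +
              Real.log (1 + ∫ x, vortSq 2 (u 0) x) + 979776) * (T + Iω))))) := by
  have h0S : (0 : ℝ) ∈ Icc 0 S := ⟨le_rfl, hS.le⟩
  have hu : ∀ τ ∈ Icc 0 S, ContDiff ℝ ∞ (u τ) := fun τ hτ => h.contDiff_velocity hτ
  have hdivτ : ∀ τ ∈ Icc 0 S, VectorCalculus.IsDivFree (u τ) := fun τ hτ => h.divFree τ hτ
  have hdiv' : ∀ τ ∈ Icc 0 S, ∀ x, ∑ i, pderiv i (fun y => u τ y i) x = 0 := fun τ hτ x =>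
    h.sum_pderiv_comp_eq_zero hτ x
  -- integrability and bounds of the coordinate tensors
  obtain ⟨⟨I₀, hI₀⟩, -⟩ := levelSq_bounds_of_hasBoundedSobolevNormsOn hu hB 0
  obtain ⟨⟨I₁, hI₁⟩, ⟨P₁, -, hP₁⟩⟩ := levelSq_bounds_of_hasBoundedSobolevNormsOn hu hB 1
  obtain ⟨⟨I₂, hI₂⟩, ⟨P₂, -, hP₂⟩⟩ := levelSq_bounds_of_hasBoundedSobolevNormsOn hu hB 2
  obtain ⟨⟨I₃, hI₃⟩, -⟩ := levelSq_bounds_of_hasBoundedSobolevNormsOn hu hB 3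
  obtain ⟨B₁, hB₁0, hB₁⟩ := exists_forall_norm_iteratedFDeriv_le_bkmClass hu hB 1
  have hDB : ∀ τ ∈ Icc 0 S, ∀ x, ‖fderiv ℝ (u τ) x‖ ≤ B₁ := fun τ hτ x => by
    rw [← norm_iteratedFDeriv_zero (𝕜 := ℝ) (f := fderiv ℝ (u τ)), norm_iteratedFDeriv_fderiv]
    exact hB₁ τ hτ x
  have hcurlB : ∀ τ ∈ Icc 0 S, ∀ x, ‖curl (u τ) x‖ ≤ 4 * B₁ := fun τ hτ x =>
    (norm_curl_le_four_mul _ x).trans (mul_le_mul_of_nonneg_left (hDB τ hτ x) (by norm_num))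
  -- the suprema `G(τ) = sup_x ‖Du‖`, `a(τ) = sup_x |curl u|` as real numbers
  set G : ℝ → ℝ := fun τ => (⨆ x, ‖fderiv ℝ (u τ) x‖ₑ).toReal with hGdef
  set a : ℝ → ℝ := fun τ => (⨆ x, ‖curl (u τ) x‖ₑ).toReal with hadef
  have hGspec : ∀ τ ∈ Icc 0 S, (∀ x, ‖fderiv ℝ (u τ) x‖ ≤ G τ) ∧ G τ ≤ B₁ := fun τ hτ =>
    ⟨(toReal_iSup_enorm_spec (hDB τ hτ)).1, (toReal_iSup_enorm_spec (hDB τ hτ)).2.1⟩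
  have haspec : ∀ τ ∈ Icc 0 S, (∀ x, ‖curl (u τ) x‖ ≤ a τ) ∧ a τ ≤ 4 * B₁ ∧
      ENNReal.ofReal (a τ) = ⨆ x, ‖curl (u τ) x‖ₑ := fun τ hτ => toReal_iSup_enorm_spec (hcurlB τ hτ)
  have hG0 : ∀ τ ∈ Icc 0 S, 0 ≤ G τ := fun τ _ => ENNReal.toReal_nonneg
  have ha0 : ∀ τ ∈ Icc 0 S, 0 ≤ a τ := fun τ _ => ENNReal.toReal_nonneg
  have haint : ∀ t ∈ Icc 0 S, (∫⁻ τ in Ioo 0 t, ENNReal.ofReal (a τ)) ≤ ENNReal.ofReal Iω := by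
    intro t ht'
    calc ∫⁻ τ in Ioo 0 t, ENNReal.ofReal (a τ) ≤ ∫⁻ τ in Ioo 0 S, ENNReal.ofReal (a τ) :=
          lintegral_mono_set (Ioo_subset_Ioo le_rfl ht'.2)
      _ = ∫⁻ τ in Ioo 0 S, ⨆ x, ‖curl (u τ) x‖ₑ :=
          setLIntegral_congr_fun measurableSet_Ioo fun τ hτ => (haspec τ ⟨hτ.1.le, hτ.2.le⟩).2.2
      _ ≤ ENNReal.ofReal Iω := hωS
  -- (1) the energy
  have hE_int : ∀ τ ∈ Icc 0 S, Integrable fun x => ‖u τ x‖ ^ 2 := fun τ hτ =>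
    (hI₀ τ hτ).1.congr (Eventually.of_forall fun x => levelSq_zero_eq_norm_sq (u τ) x)
  have hE : ∀ τ ∈ Icc 0 S, ∫ x, ‖u τ x‖ ^ 2 ≤ ∫ x, ‖u 0 x‖ ^ 2 := fun τ hτ => h.bkm_energy_le hν hS hB hτ
  set E₀ : ℝ := ∫ x, ‖u 0 x‖ ^ 2 with hE₀
  have hE₀0 : 0 ≤ E₀ := integral_nonneg fun x => sq_nonneg _
  -- (2) the enstrophy
  have hX0int : ∀ τ ∈ Icc 0 S, Integrable (vortSq 0 (u τ)) := fun τ hτ =>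
    ((hI₁ τ hτ).1.const_mul 4).mono' (continuous_vortSq (hu τ hτ) 0).aestronglyMeasurable
      (Eventually.of_forall fun x => by
        rw [Real.norm_of_nonneg (vortSq_nonneg 0 _ x)]; exact vortSq_le_four_mul_levelSq_succ (hu τ hτ) 0 x)
  have hX0bd : ∀ τ ∈ Icc 0 S, ∫ x, vortSq 0 (u τ) x ≤ 4 * I₁ := fun τ hτ => by
    calc ∫ x, vortSq 0 (u τ) x ≤ ∫ x, 4 * levelSq 1 (u τ) x :=
          integral_mono (hX0int τ hτ) ((hI₁ τ hτ).1.const_mul 4) fun x =>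
            vortSq_le_four_mul_levelSq_succ (hu τ hτ) 0 x
      _ = 4 * ∫ x, levelSq 1 (u τ) x := integral_const_mul _ _
      _ ≤ 4 * I₁ := by linarith [(hI₁ τ hτ).2]
  have hX0nn : ∀ τ ∈ Icc 0 S, 0 ≤ ∫ x, vortSq 0 (u τ) x := fun τ _ =>
    integral_nonneg fun x => vortSq_nonneg 0 _ x
  have hX0ineq := fun t' (ht' : t' ∈ Icc 0 S) =>
    h.bkm_vortSq_zero_le hν hS hB (fun τ hτ => (haspec τ hτ).1) (fun τ hτ => (haspec τ hτ).2.1) ht'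
  have hc432 : ∀ t' ∈ Icc 0 S, (∫⁻ τ in Ioo 0 t', ENNReal.ofReal (432 * a τ)) ≤ ENNReal.ofReal (432 * Iω) := by
    intro t' ht'
    have e : (fun τ => ENNReal.ofReal (432 * a τ)) = fun τ => ENNReal.ofReal 432 * ENNReal.ofReal (a τ) :=
      funext fun τ => ENNReal.ofReal_mul (by norm_num)
    rw [e, lintegral_const_mul' _ _ ENNReal.ofReal_ne_top, ENNReal.ofReal_mul (by norm_num)]
    exact mul_le_mul_right (haint t' ht') _
  have hX0G := real_gronwall_of_lintegral_bound (S := S) (X := fun τ => ∫ x, vortSq 0 (u τ) x)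
    (c := fun τ => 432 * a τ) hX0nn hX0bd (fun τ hτ => by positivity [ha0 τ hτ])
    (ne_top_of_le_ne_top ENNReal.ofReal_ne_top (hc432 S ⟨hS.le, le_rfl⟩))
    (fun t' ht' => hX0ineq t' ht')
  set X0s : ℝ := (∫ x, vortSq 0 (u 0) x) * Real.exp (432 * Iω) with hX0s
  have hX0fin : ∀ τ ∈ Icc 0 S, ∫ x, vortSq 0 (u τ) x ≤ X0s := by
    intro τ hτ
    refine (hX0G τ hτ).trans (mul_le_mul_of_nonneg_left (Real.exp_le_exp.2 ?_) (hX0nn 0 h0S))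
    have h1 := ENNReal.toReal_mono ENNReal.ofReal_ne_top (hc432 τ hτ)
    rwa [ENNReal.toReal_ofReal (by positivity)] at h1
  have hX0s0 : 0 ≤ X0s := (hX0nn 0 h0S).trans (hX0fin 0 h0S)
  -- (3) the `H³` level
  have hX2int : ∀ τ ∈ Icc 0 S, Integrable (vortSq 2 (u τ)) := fun τ hτ =>
    ((hI₃ τ hτ).1.const_mul 4).mono' (continuous_vortSq (hu τ hτ) 2).aestronglyMeasurable
      (Eventually.of_forall fun x => by
        rw [Real.norm_of_nonneg (vortSq_nonneg 2 _ x)]; exact vortSq_le_four_mul_levelSq_succ (hu τ hτ) 2 x)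
  have hX2bd : ∀ τ ∈ Icc 0 S, ∫ x, vortSq 2 (u τ) x ≤ 4 * I₃ := fun τ hτ => by
    calc ∫ x, vortSq 2 (u τ) x ≤ ∫ x, 4 * levelSq 3 (u τ) x :=
          integral_mono (hX2int τ hτ) ((hI₃ τ hτ).1.const_mul 4) fun x =>
            vortSq_le_four_mul_levelSq_succ (hu τ hτ) 2 x
      _ = 4 * ∫ x, levelSq 3 (u τ) x := integral_const_mul _ _
      _ ≤ 4 * I₃ := by linarith [(hI₃ τ hτ).2]
  have hX2nn : ∀ τ ∈ Icc 0 S, 0 ≤ ∫ x, vortSq 2 (u τ) x := fun τ _ =>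
    integral_nonneg fun x => vortSq_nonneg 2 _ x
  have hX2ineq := fun t' (ht' : t' ∈ Icc 0 S) =>
    h.bkm_vortSq_two_le hν hS hB (fun τ hτ => (hGspec τ hτ).1) (fun τ hτ => (hGspec τ hτ).2) ht'
  have hKG : ∀ t' ∈ Icc 0 S, (∫⁻ τ in Ioo 0 t', ENNReal.ofReal (979776 * G τ)) =
      ENNReal.ofReal 979776 * ∫⁻ τ in Ioo 0 t', ENNReal.ofReal (G τ) := by
    intro t' _
    have e : (fun τ => ENNReal.ofReal (979776 * G τ)) = fun τ => ENNReal.ofReal 979776 * ENNReal.ofReal (G τ) :=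
      funext fun τ => ENNReal.ofReal_mul (by norm_num)
    rw [e, lintegral_const_mul' _ _ ENNReal.ofReal_ne_top]
  have hΛfin : ∀ t' ∈ Icc 0 S, (∫⁻ τ in Ioo 0 t', ENNReal.ofReal (G τ)) ≤ ENNReal.ofReal B₁ * ENNReal.ofReal S := by
    intro t' ht'
    calc (∫⁻ τ in Ioo 0 t', ENNReal.ofReal (G τ)) ≤ ∫⁻ _ in Ioo (0 : ℝ) t', ENNReal.ofReal B₁ :=
          setLIntegral_mono' measurableSet_Ioo fun τ hτ =>
            ENNReal.ofReal_le_ofReal ((hGspec τ ⟨hτ.1.le, hτ.2.le.trans ht'.2⟩).2)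
      _ = ENNReal.ofReal B₁ * ENNReal.ofReal t' := by rw [setLIntegral_const, Real.volume_Ioo, sub_zero]
      _ ≤ ENNReal.ofReal B₁ * ENNReal.ofReal S := mul_le_mul_right (ENNReal.ofReal_le_ofReal ht'.2) _
  have hΛtop : ∀ t' ∈ Icc 0 S, (∫⁻ τ in Ioo 0 t', ENNReal.ofReal (G τ)) ≠ ⊤ := fun t' ht' =>
    ne_top_of_le_ne_top (ENNReal.mul_ne_top ENNReal.ofReal_ne_top ENNReal.ofReal_ne_top) (hΛfin t' ht')
  have hX2G := real_gronwall_of_lintegral_bound (S := S) (X := fun τ => ∫ x, vortSq 2 (u τ) x)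
    (c := fun τ => 979776 * G τ) hX2nn hX2bd (fun τ hτ => by positivity [hG0 τ hτ])
    (by rw [hKG S ⟨hS.le, le_rfl⟩]; exact ENNReal.mul_ne_top ENNReal.ofReal_ne_top (hΛtop S ⟨hS.le, le_rfl⟩))
    (fun t' ht' => hX2ineq t' ht')
  -- `Λ(τ) = ∫_{(0,τ)} G` and the bound `X₂(τ) ≤ X₂(0) exp(K Λ(τ))`
  set Λ : ℝ → ℝ := fun τ => (∫⁻ s in Ioo 0 τ, ENNReal.ofReal (G s)).toReal with hΛ
  have hΛ0 : ∀ τ, 0 ≤ Λ τ := fun τ => ENNReal.toReal_nonneg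
  have hX2exp : ∀ τ ∈ Icc 0 S, ∫ x, vortSq 2 (u τ) x ≤ (∫ x, vortSq 2 (u 0) x) * Real.exp (979776 * Λ τ) := by
    intro τ hτ
    refine (hX2G τ hτ).trans (le_of_eq ?_)
    congr 2
    rw [hKG τ hτ, ENNReal.toReal_mul, ENNReal.toReal_ofReal (by norm_num)]
  -- (4) the logarithmic estimate and (5) Grönwall for `Λ`
  set X20 : ℝ := ∫ x, vortSq 2 (u 0) x with hX20
  have hX200 : 0 ≤ X20 := hX2nn 0 h0S
  set K₀ : ℝ := CL * (36 * CH + Real.sqrt E₀ + 1 + Real.log (1 + X20) + 979776) with hK₀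
  have hCH0 : (0 : ℝ) ≤ CH := CH.coe_nonneg
  have hlog20 : 0 ≤ Real.log (1 + X20) := Real.log_nonneg (by linarith)
  have hK₀0 : 0 ≤ K₀ := by rw [hK₀]; positivity
  have hGlog : ∀ τ ∈ Icc 0 S, G τ ≤ K₀ * (1 + a τ) * (1 + Λ τ) := by
    intro τ hτ
    have hL3 : ∫ x, levelSq 3 (u τ) x ≤ ∫ x, vortSq 2 (u τ) x :=
      integral_levelSq_succ_le_integral_vortSq (hu τ hτ) (hdiv' τ hτ) 2 (hI₂ τ hτ).1 (hI₃ τ hτ).1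
    have hpt : ∀ x, ‖fderiv ℝ (u τ) x‖ ≤ CL * (36 * CH + a τ + a τ * Real.log (1 + ∫ x, vortSq 2 (u τ) x) +
        Real.sqrt (∫ y, ‖u τ y‖ ^ 2)) := fun x =>
      opNorm_fderiv_le_bkm_log hCL0 hCL hCH (hu τ hτ) (hdivτ τ hτ) (hE_int τ hτ) (hI₂ τ hτ).1
        (hI₃ τ hτ).1 hL3 (haspec τ hτ).1 x
    have hGle := (toReal_iSup_enorm_spec hpt).2.1
    have hlog := log_one_add_le_of_le_mul_exp (hX2nn τ hτ) hX200 (by positivity [hΛ0 τ]) (hX2exp τ hτ)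
    have hsq : Real.sqrt (∫ y, ‖u τ y‖ ^ 2) ≤ Real.sqrt E₀ := Real.sqrt_le_sqrt (hE τ hτ)
    have haτ := ha0 τ hτ
    have hΛτ := hΛ0 τ
    have h1 : a τ * Real.log (1 + ∫ x, vortSq 2 (u τ) x) ≤ a τ * (Real.log (1 + X20) + 979776 * Λ τ) :=
      mul_le_mul_of_nonneg_left hlog haτ
    have hE0s := Real.sqrt_nonneg E₀
    have hM : 36 * CH + a τ + a τ * Real.log (1 + ∫ x, vortSq 2 (u τ) x) + Real.sqrt (∫ y, ‖u τ y‖ ^ 2) ≤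
        (36 * CH + Real.sqrt E₀ + 1 + Real.log (1 + X20) + 979776) * ((1 + a τ) * (1 + Λ τ)) := by
      nlinarith [h1, hsq, mul_nonneg hCH0 haτ, mul_nonneg hE0s haτ, mul_nonneg hCH0 hΛτ,
        mul_nonneg hE0s hΛτ, mul_nonneg hlog20 hΛτ, mul_nonneg (mul_nonneg hCH0 haτ) hΛτ,
        mul_nonneg (mul_nonneg hE0s haτ) hΛτ, mul_nonneg haτ hΛτ,
        mul_nonneg (mul_nonneg hlog20 haτ) hΛτ, mul_nonneg hlog20 haτ]
    calc G τ ≤ _ := hGle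
      _ ≤ CL * ((36 * CH + Real.sqrt E₀ + 1 + Real.log (1 + X20) + 979776) * ((1 + a τ) * (1 + Λ τ))) :=
          mul_le_mul_of_nonneg_left hM hCL0
      _ = K₀ * (1 + a τ) * (1 + Λ τ) := by rw [hK₀]; ring
  have hΛexp := toReal_lintegral_le_exp_of_log_gronwall hS.le hG0 (fun τ hτ => (hGspec τ hτ).2) ha0
    (haint S ⟨hS.le, le_rfl⟩) hIω0 hK₀0 hGlog
  set Ψ : ℝ := Real.exp (K₀ * (T + Iω)) with hΨ
  have hΛΨ : ∀ τ ∈ Icc 0 S, Λ τ ≤ Ψ := fun τ hτ =>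
    (hΛexp τ hτ).trans (Real.exp_le_exp.2 (mul_le_mul_of_nonneg_left (by linarith) hK₀0))
  set X2s : ℝ := X20 * Real.exp (979776 * Ψ) with hX2s
  have hX2fin : ∀ τ ∈ Icc 0 S, ∫ x, vortSq 2 (u τ) x ≤ X2s := fun τ hτ =>
    (hX2exp τ hτ).trans (mul_le_mul_of_nonneg_left (Real.exp_le_exp.2
      (mul_le_mul_of_nonneg_left (hΛΨ τ hτ) (by norm_num))) hX200)
  have hX2s0 : 0 ≤ X2s := by rw [hX2s]; positivity
  -- (6) the Sobolev seminorms at time `t`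
  have hv := hu t ht
  have hL0 : ∫ x, levelSq 0 (u t) x ≤ E₀ := by
    rw [integral_congr_ae (Eventually.of_forall fun x => levelSq_zero_eq_norm_sq (u t) x)]; exact hE t ht
  have hL1 : ∫ x, levelSq 1 (u t) x ≤ X0s :=
    (integral_levelSq_succ_le_integral_vortSq hv (hdiv' t ht) 0 (hI₀ t ht).1 (hI₁ t ht).1).trans (hX0fin t ht)
  have hL3 : ∫ x, levelSq 3 (u t) x ≤ X2s :=
    (integral_levelSq_succ_le_integral_vortSq hv (hdiv' t ht) 2 (hI₂ t ht).1 (hI₃ t ht).1).trans (hX2fin t ht)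
  have hL2 : ∫ x, levelSq 2 (u t) x ≤ (3 * X0s + X2s) / 2 := by
    have := integral_levelSq_two_le_of_one_three hv (hP₁ t ht) (hP₂ t ht) (hI₁ t ht).1 (hI₂ t ht).1
      (hI₃ t ht).1
    refine this.trans ?_
    gcongr
  have hlin : ∀ m : ℕ, ∀ {Y : ℝ}, ∫ x, levelSq m (u t) x ≤ Y →
      ∫⁻ x, ‖iteratedFDeriv ℝ m (u t) x‖ₑ ^ 2 ≤ ENNReal.ofReal (3 ^ (m + 1) * Y) := by
    intro m Y hY
    have hint : Integrable (levelSq m (u t)) := by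
      rcases m with _ | _ | _ | _ | m
      · exact (hI₀ t ht).1
      · exact (hI₁ t ht).1
      · exact (hI₂ t ht).1
      · exact (hI₃ t ht).1
      · exact (levelSq_bounds_of_hasBoundedSobolevNormsOn hu hB (m + 4)).1.choose_spec t ht |>.1
    exact (lintegral_sq_norm_iteratedFDeriv_le hv m hint).trans
      (ENNReal.ofReal_le_ofReal (mul_le_mul_of_nonneg_left hY (by positivity)))
  rw [Finset.sum_range_succ, Finset.sum_range_succ, Finset.sum_range_succ, Finset.sum_range_one]
  calc (∫⁻ x, ‖iteratedFDeriv ℝ 0 (u t) x‖ₑ ^ 2) + (∫⁻ x, ‖iteratedFDeriv ℝ 1 (u t) x‖ₑ ^ 2) +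
        (∫⁻ x, ‖iteratedFDeriv ℝ 2 (u t) x‖ₑ ^ 2) + (∫⁻ x, ‖iteratedFDeriv ℝ 3 (u t) x‖ₑ ^ 2)
      ≤ ENNReal.ofReal (3 ^ (0 + 1) * E₀) + ENNReal.ofReal (3 ^ (1 + 1) * X0s) +
          ENNReal.ofReal (3 ^ (2 + 1) * ((3 * X0s + X2s) / 2)) + ENNReal.ofReal (3 ^ (3 + 1) * X2s) :=
        add_le_add (add_le_add (add_le_add (hlin 0 hL0) (hlin 1 hL1)) (hlin 2 hL2)) (hlin 3 hL3)
    _ = ENNReal.ofReal (3 * E₀ + 9 * X0s + 27 * ((3 * X0s + X2s) / 2) + 81 * X2s) := by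
        rw [ENNReal.ofReal_add (by positivity) (by positivity),
          ENNReal.ofReal_add (by positivity) (by positivity),
          ENNReal.ofReal_add (by positivity) (by positivity)]
        norm_num

end Slab

/-! ## The discharge -/

/-- **Discharge of `MajdaBertozzi2002_bkmAprioriH3`** (Majda–Bertozzi 2002, proof of Thm. 3.6,
§3.3, pp. 116–117: (3.79) with `m = 3`, (3.80)–(3.82), the potential theory estimate Prop. 3.8
(3.83), Grönwall): for `ν ≥ 0`, `T > 0` and a classical unforced solution `(u, p)` on
`ℝ³ × [0, T)` with all `L²` Sobolev norms bounded on every `[0, T'']`, `T'' < T`, if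
`∫₀ᵀ ‖curl u(t)‖_{L^∞} dt < ∞` then `Σ_{n ≤ 3} ∫‖Dⁿu(t)‖²` is bounded uniformly in
`t ∈ [0, T)`. Each `t < T` lies in a closed slab `[0, S]`, `S = (t + T)/2 < T`, on which
`IsClassicalNSSolutionOn.bkm_slab_bound` applies with the `S`-independent constant built from the
data at time `0`, `T`, `∫₀ᵀ sup|curl u|` and the absolute constants of the logarithmic estimate.
[cite: MajdaBertozzi2002, Thm. 3.6 and its proof, (3.79)–(3.83), Prop. 3.8 (pp. 115–117)] -/
theorem MajdaBertozzi2002_bkmAprioriH3_holds : MajdaBertozzi2002_bkmAprioriH3 := by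
  intro ν hν T hT u p hsol hreg hω
  obtain ⟨CL, hCL0, hCL⟩ := exists_opNorm_fderiv_le_log
  obtain ⟨CH, hCH⟩ := exists_holderWith_curl
  set Iω : ℝ := (∫⁻ t in Ioo 0 T, ⨆ x, ‖curl (u t) x‖ₑ).toReal with hIω
  have hIω0 : 0 ≤ Iω := ENNReal.toReal_nonneg
  set A : ℝ := 3 * (∫ x, ‖u 0 x‖ ^ 2) +
        9 * ((∫ x, vortSq 0 (u 0) x) * Real.exp (432 * Iω)) +
        27 * ((3 * ((∫ x, vortSq 0 (u 0) x) * Real.exp (432 * Iω)) +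
          (∫ x, vortSq 2 (u 0) x) * Real.exp (979776 * Real.exp
            (CL * (36 * CH + Real.sqrt (∫ x, ‖u 0 x‖ ^ 2) + 1 +
              Real.log (1 + ∫ x, vortSq 2 (u 0) x) + 979776) * (T + Iω)))) / 2) +
        81 * ((∫ x, vortSq 2 (u 0) x) * Real.exp (979776 * Real.exp
            (CL * (36 * CH + Real.sqrt (∫ x, ‖u 0 x‖ ^ 2) + 1 +
              Real.log (1 + ∫ x, vortSq 2 (u 0) x) + 979776) * (T + Iω)))) with hA
  refine ⟨A.toNNReal, fun t ht => ?_⟩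
  -- the slab `[0, S]`, `S = (t + T)/2`
  set S : ℝ := (t + T) / 2 with hS
  have hS0 : 0 < S := by rw [hS]; linarith [ht.1]
  have hST : S < T := by rw [hS]; linarith [ht.2]
  have htS : t ∈ Icc 0 S := ⟨ht.1, by rw [hS]; linarith [ht.2]⟩
  have h := hsol.mono (Icc_subset_Ico_right hST) (uniqueDiffOn_Icc hS0)
  have hB := hreg S hST
  have hωS : (∫⁻ τ in Ioo 0 S, ⨆ x, ‖curl (u τ) x‖ₑ) ≤ ENNReal.ofReal Iω := by
    rw [hIω, ENNReal.ofReal_toReal hω.ne]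
    exact lintegral_mono_set (Ioo_subset_Ioo le_rfl hST.le)
  have hmain := h.bkm_slab_bound hν hS0 hB hCL0 hCL hCH hIω0 hωS hST.le htS
  rw [← hA] at hmain
  exact hmain.trans (le_of_eq rfl)

end Literature.Analysis.FluidPDE
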